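import Summits.CriticalPhenomena.CardyFormulaZ2.Theorems.DyadicBetaRigidityDyadicLatticeBetaLawStubClusterLawPrelims
import Summits.CriticalPhenomena.CardyFormulaZ2.Theorems.CardyWhiteToColouredSimilarityUpgradeStubRectangleFamily
import Summits.CriticalPhenomena.CardyFormulaZ2.Theorems.DyadicLatticeBetaLaw.Negative.DyadicLatticeBetaLawFalseWithoutUniformizing
import Summits.CriticalPhenomena.CardyFormulaZ2.Theorems.DyadicBetaRigidityDyadicBetaSufficesDilation
import Literature.Probability.RandomPlanarGeometry.ConformalRectangleProofs

/-!
# Stub S5b `stub_clusterLawOfComparison` of line `Sketch` (crux `DyadicLatticeBetaLaw`,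
# stmt-CriticalPhenomena-18183, route DyadicBetaRigidity of `CardyFormulaZ2`)

Bookkeeping: the equicontinuous comparison hypothesis (stub S1) and the subsequential box limits
(stub S5a) imply that through every cluster point `p` of the dyadic crossing sequence
`k ↦ P[R₀, h₀/2^k]` of a lattice polygon `R₀` (along a strictly increasing `κ`) passes a law
`f : ℝ → ℝ`, continuous on `(0,1)` and self-dual (`f (1 - η) = 1 - f η`), with `f (η_{R₀}) = p`, to
which EVERY lattice polygon `P` of every mesh `h` converges along every shifted ladder
`h 2^j / 2^(κ (σ n))` of a common sub-subsequence `κ ∘ σ`.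

Proof.  The real analysis is the abstract scheme `stub_clusterLawOfComparison_abstract` of the
support file `…StubClusterLawPrelims.lean`; this file instantiates it:

* ladders `L t u`: `u = (k ↦ P[R, h/2^k])` for a lattice polygon `R` of `hℤ²` with a uniformizing
  datum of cross-ratio `t`; comparison = stub S1 verbatim; refinement `h ↦ h/2^j`
  (`DyadicLattice.latticePolygon_refine`); moduli in `(0,1)`
  (`ConformalRectangle.crossRatio_mem_Ioo_of_isUniformizing`);
* boxes: the landed families `Q w`, `Q' w` of `stub_rectangleFamily` (carriers `(0,w) × (0,1)`,
  arcs `0, 2` = left/right resp. bottom/top sides, flip `η(Q' w) = 1 - η(Q w)`, every modulus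
  attained, modulus continuous in `w`), with a CHOSEN uniformizing datum of each box
  (`MarkedDomain.exists_isUniformizing_holds`); a box of dyadic width `a/2^m` is a lattice polygon
  of `(1/2^m)ℤ²` (`DyadicLatticeBetaLaw.Negative.isLatticePolygon_box`);
* box limits `g`, `g' = 1 - g` along `κ ∘ σ` = stub S5a (a hypothesis here);
* `f (η_{R₀}) = p` by uniqueness of limits; the shifted ladders by `h 2^j / 2^(j+i) = h / 2^i`.

References: B. Bollobás, O. Riordan, *Percolation* (2006), Ch. 7 §7.1; the scheme is the line's
own bookkeeping (idea card `equimodular-comparison`).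
-/

noncomputable section
open MeasureTheory Filter Set Metric Topology
open UpperHalfPlane (upperHalfPlaneSet)
open Literature.Probability.RandomPlanarGeometry Literature.Probability.LatticeModels
open Literature.Probability.Percolation
namespace Summit.CriticalPhenomena.CardyFormulaZ2.Cruxes.DyadicLatticeBetaLaw.Stubs

open Summit.CriticalPhenomena.CardyFormulaZ2.Cruxes.SimilarityUpgrade.Stubs (stub_rectangleFamily)
open Summit.CriticalPhenomena.CardyFormulaZ2.Theorems.DyadicLatticeBetaLaw.Negative
  (isLatticePolygon_box)
open Summit.CriticalPhenomena.CardyFormulaZ2.Theorems.DyadicLattice (latticePolygon_refine)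

namespace ClusterLaw

/-- Mesh arithmetic of the shifted ladders: `h 2^j / 2^(j+i) = h / 2^i`. [folklore] -/
theorem mul_pow_div_pow_add (h : ℝ) (j i : ℕ) : h * 2 ^ j / 2 ^ (j + i) = h / 2 ^ i := by
  rw [pow_add, mul_comm h, mul_div_mul_left _ _ (pow_ne_zero _ two_ne_zero)]

/-- **A box of dyadic width is a lattice polygon**: a conformal rectangle with carrier
`(0, a/2^m) × (0, 1)` (`a ≥ 1`) has its frontier covered by finitely many edges of `(1/2^m)ℤ²`
(`isLatticePolygon_box` with `M = a`, `N = 2^m`). [folklore] -/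
theorem isLatticePolygon_dyadicBox {a : ℕ} (m : ℕ) (ha : 0 < a) (R : ConformalRectangle)
    (hR : R.carrier = (Ioo (0 : ℝ) ((a : ℝ) / 2 ^ m) ×ℂ Ioo (0 : ℝ) 1)) :
    ∃ S : Finset (ℂ × ℂ), (∀ p ∈ S, ∃ u v : Site 2, (zdGraph 2).Adj u v ∧
      p.1 = meshPoint (1 / 2 ^ m) u ∧ p.2 = meshPoint (1 / 2 ^ m) v) ∧
      frontier R.carrier ⊆ ⋃ p ∈ S, segment ℝ p.1 p.2 :=
  isLatticePolygon_box (h := 1 / 2 ^ m) (M := a) (N := 2 ^ m) (by positivity) ha (by positivity) R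
    (by rw [hR]; push_cast; rw [one_div_mul_cancel (pow_ne_zero m two_ne_zero), one_div_mul_eq_div])

end ClusterLaw

open ClusterLaw in
/-- **STUB S5b — the cluster law from comparison** (bookkeeping).  Assume S1 (equicontinuous
comparison of near-equimodular lattice polygons along the dyadic ladders) and S5a (subsequential
limits `g`, `g'` of the corner-marked boxes, continuous in the width, `g + g' = 1`).  Let `R₀` be a
lattice polygon of `h₀ℤ²` with uniformizing datum `(φ₀, x₀)` and let `p` be the limit of its
crossing probabilities along `h₀/2^(κ n)` for a strictly increasing `κ`.  Then along a
sub-subsequence `κ ∘ σ` there is a law `f`, continuous on `(0,1)` with `f (1-η) = 1 - f η` there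
and `f (η_{R₀}) = p`, such that EVERY lattice polygon `P` of every mesh `h` converges along every
shifted ladder `h 2^j / 2^(κ (σ n))` to `f (η_P)`.  (`σ, g, g'` from S5a for the landed families
`stub_rectangleFamily`; `f := g ∘ w(·)` with `w(t)` a width of modulus `t`; transfer from dyadic
boxes to arbitrary lattice polygons, shift-invariance and well-definedness by S1
(`stub_clusterLawOfComparison_abstract`); symmetry from `g + g' = 1` and the bottom–top boxes of
modulus `1 - η(w)`; `f (η_{R₀}) = p` by uniqueness of limits.)
[cite: BollobasRiordan2006, Ch. 7 §7.1] -/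
theorem stub_clusterLawOfComparison :
    (∀ ε : ℝ, 0 < ε → ∀ η ∈ Set.Ioo (0 : ℝ) 1, ∃ θ : ℝ, 0 < θ ∧
      ∀ h h' : ℝ, 0 < h → 0 < h' → ∀ R R' : ConformalRectangle,
        (∃ S : Finset (ℂ × ℂ), (∀ p ∈ S, ∃ u v : Site 2, (zdGraph 2).Adj u v ∧
            p.1 = meshPoint h u ∧ p.2 = meshPoint h v) ∧
            frontier R.carrier ⊆ ⋃ p ∈ S, segment ℝ p.1 p.2) →
        (∃ S : Finset (ℂ × ℂ), (∀ p ∈ S, ∃ u v : Site 2, (zdGraph 2).Adj u v ∧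
            p.1 = meshPoint h' u ∧ p.2 = meshPoint h' v) ∧
            frontier R'.carrier ⊆ ⋃ p ∈ S, segment ℝ p.1 p.2) →
        ∀ (φ : ConformalEquiv upperHalfPlaneSet R.carrier) (x : Fin 4 → ℝ)
          (φ' : ConformalEquiv upperHalfPlaneSet R'.carrier) (x' : Fin 4 → ℝ),
          R.IsUniformizing φ x → R'.IsUniformizing φ' x' →
          |crossRatio x - η| < θ → |crossRatio x' - η| < θ →
          ∀ᶠ k : ℕ in atTop,
            |bondDomainCrossingProb R (h / 2 ^ k) - bondDomainCrossingProb R' (h' / 2 ^ k)| < ε) →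
    (∀ (Q Q' : ℝ → ConformalRectangle),
      (∀ w : ℝ, 0 < w → (Q w).carrier = (Set.Ioo (0 : ℝ) w ×ℂ Set.Ioo (0 : ℝ) 1) ∧
        (Q w).arc 0 = {z : ℂ | z.re = 0 ∧ z.im ∈ Set.Icc (0 : ℝ) 1} ∧
        (Q w).arc 2 = {z : ℂ | z.re = w ∧ z.im ∈ Set.Icc (0 : ℝ) 1}) →
      (∀ w : ℝ, 0 < w → (Q' w).carrier = (Set.Ioo (0 : ℝ) w ×ℂ Set.Ioo (0 : ℝ) 1) ∧
        (Q' w).arc 0 = {z : ℂ | z.im = 0 ∧ z.re ∈ Set.Icc (0 : ℝ) w} ∧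
        (Q' w).arc 2 = {z : ℂ | z.im = 1 ∧ z.re ∈ Set.Icc (0 : ℝ) w}) →
      ∀ κ : ℕ → ℕ, StrictMono κ → ∃ σ : ℕ → ℕ, StrictMono σ ∧ ∃ g g' : ℝ → ℝ,
        ContinuousOn g (Set.Ioi 0) ∧ ContinuousOn g' (Set.Ioi 0) ∧
        (∀ w : ℝ, 0 < w → g w + g' w = 1) ∧
        ∀ w : ℝ, 0 < w →
          Tendsto (fun n : ℕ => bondDomainCrossingProb (Q w) (1 / 2 ^ (κ (σ n)))) atTop (𝓝 (g w)) ∧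
          Tendsto (fun n : ℕ => bondDomainCrossingProb (Q' w) (1 / 2 ^ (κ (σ n)))) atTop
            (𝓝 (g' w))) →
    ∀ h₀ : ℝ, 0 < h₀ → ∀ R₀ : ConformalRectangle,
      (∃ S : Finset (ℂ × ℂ), (∀ p ∈ S, ∃ u v : Site 2, (zdGraph 2).Adj u v ∧
          p.1 = meshPoint h₀ u ∧ p.2 = meshPoint h₀ v) ∧
          frontier R₀.carrier ⊆ ⋃ p ∈ S, segment ℝ p.1 p.2) →
      ∀ (φ₀ : ConformalEquiv upperHalfPlaneSet R₀.carrier) (x₀ : Fin 4 → ℝ), R₀.IsUniformizing φ₀ x₀ →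
        ∀ κ : ℕ → ℕ, StrictMono κ → ∀ p : ℝ,
          Tendsto (fun n : ℕ => bondDomainCrossingProb R₀ (h₀ / 2 ^ (κ n))) atTop (𝓝 p) →
          ∃ σ : ℕ → ℕ, StrictMono σ ∧ ∃ f : ℝ → ℝ, ContinuousOn f (Set.Ioo 0 1) ∧
            (∀ η ∈ Set.Ioo (0 : ℝ) 1, f (1 - η) = 1 - f η) ∧ f (crossRatio x₀) = p ∧
            ∀ h : ℝ, 0 < h → ∀ P : ConformalRectangle,
              (∃ S : Finset (ℂ × ℂ), (∀ p ∈ S, ∃ u v : Site 2, (zdGraph 2).Adj u v ∧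
                  p.1 = meshPoint h u ∧ p.2 = meshPoint h v) ∧
                  frontier P.carrier ⊆ ⋃ p ∈ S, segment ℝ p.1 p.2) →
              ∀ (ψ : ConformalEquiv upperHalfPlaneSet P.carrier) (y : Fin 4 → ℝ),
                P.IsUniformizing ψ y →
                ∀ j : ℕ, Tendsto (fun n : ℕ => bondDomainCrossingProb P (h * 2 ^ j / 2 ^ (κ (σ n))))
                  atTop (𝓝 (f (crossRatio y))) := by
  intro hEQ hRL h₀ hh₀ R₀ hR₀ φ₀ x₀ hφ₀ κ hκ p hp
  -- (0) the landed rectangle families and the box limits (S5a) along a sub-subsequence `κ ∘ σ`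
  obtain ⟨Q, Q', hQ, hQ', -, hflip, hsurj, hmod⟩ := stub_rectangleFamily
  obtain ⟨σ, hσ, g, g', hgc, -, hsum, hlim⟩ := hRL Q Q' hQ hQ' κ hκ
  have hk : Tendsto (fun n => κ (σ n)) atTop atTop := (hκ.comp hσ).tendsto_atTop
  -- chosen uniformizing data of the boxes
  have hexQ : ∀ w : ℝ, ∃ (φ : ConformalEquiv upperHalfPlaneSet (Q w).carrier) (x : Fin 4 → ℝ),
      (Q w).IsUniformizing φ x := fun w => MarkedDomain.exists_isUniformizing_holds (Q w)
  have hexQ' : ∀ w : ℝ, ∃ (φ : ConformalEquiv upperHalfPlaneSet (Q' w).carrier) (x : Fin 4 → ℝ),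
      (Q' w).IsUniformizing φ x := fun w => MarkedDomain.exists_isUniformizing_holds (Q' w)
  choose φQ xQ hφQ using hexQ
  choose φQ' xQ' hφQ' using hexQ'
  -- the ladders: dyadic crossing sequences of lattice polygons with a datum of cross-ratio `t`
  set L : ℝ → (ℕ → ℝ) → Prop := fun t u => ∃ h : ℝ, 0 < h ∧ ∃ R : ConformalRectangle,
    (∃ S : Finset (ℂ × ℂ), (∀ p ∈ S, ∃ u v : Site 2, (zdGraph 2).Adj u v ∧
      p.1 = meshPoint h u ∧ p.2 = meshPoint h v) ∧
      frontier R.carrier ⊆ ⋃ p ∈ S, segment ℝ p.1 p.2) ∧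
    ∃ (φ : ConformalEquiv upperHalfPlaneSet R.carrier) (x : Fin 4 → ℝ), R.IsUniformizing φ x ∧
      crossRatio x = t ∧ u = fun i => bondDomainCrossingProb R (h / 2 ^ i)
  -- comparison (S1)
  have H1 : ∀ ε : ℝ, 0 < ε → ∀ t ∈ Set.Ioo (0 : ℝ) 1, ∃ θ : ℝ, 0 < θ ∧
      ∀ (t₁ t₂ : ℝ) (u₁ u₂ : ℕ → ℝ), L t₁ u₁ → L t₂ u₂ → |t₁ - t| < θ → |t₂ - t| < θ →
        ∀ᶠ i : ℕ in atTop, |u₁ i - u₂ i| < ε := by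
    intro ε hε t ht
    obtain ⟨θ, hθ, H⟩ := hEQ ε hε t ht
    refine ⟨θ, hθ, ?_⟩
    rintro t₁ t₂ u₁ u₂ ⟨h₁, hh₁, R₁, hR₁, φ₁, x₁, hφ₁, rfl, rfl⟩
      ⟨h₂, hh₂, R₂, hR₂, φ₂, x₂, hφ₂, rfl, rfl⟩ ht₁ ht₂
    exact H h₁ h₂ hh₁ hh₂ R₁ R₂ hR₁ hR₂ φ₁ x₁ φ₂ x₂ hφ₁ hφ₂ ht₁ ht₂
  -- refinement `h ↦ h / 2^j`
  have H2 : ∀ (t : ℝ) (u : ℕ → ℝ), L t u → ∀ j : ℕ, L t (fun i => u (j + i)) := by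
    rintro t u ⟨h, hh, R, hR, φ, x, hφ, hx, rfl⟩ j
    refine ⟨h / 2 ^ j, by positivity, R, ?_, φ, x, hφ, hx, funext fun i =>
      congrArg _ (by rw [pow_add, div_div] : h / 2 ^ (j + i) = h / 2 ^ j / 2 ^ i)⟩
    have := latticePolygon_refine R (N := 2 ^ j) (by positivity) hR
    push_cast at this
    exact this
  -- moduli in `(0,1)`
  have H3 : ∀ (t : ℝ) (u : ℕ → ℝ), L t u → t ∈ Set.Ioo (0 : ℝ) 1 := by
    rintro t u ⟨h, -, R, -, φ, x, hφ, rfl, -⟩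
    exact ConformalRectangle.crossRatio_mem_Ioo_of_isUniformizing hφ
  -- boxes of dyadic width are ladders (left–right: modulus `η(w)`; bottom–top: `1 - η(w)`)
  have H4 : ∀ a m : ℕ, 0 < a →
      L (crossRatio (xQ ((a : ℝ) / 2 ^ m)))
        (fun i => bondDomainCrossingProb (Q ((a : ℝ) / 2 ^ m)) (1 / 2 ^ (m + i))) ∧
      L (1 - crossRatio (xQ ((a : ℝ) / 2 ^ m)))
        (fun i => bondDomainCrossingProb (Q' ((a : ℝ) / 2 ^ m)) (1 / 2 ^ (m + i))) := by
    intro a m ha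
    have hw : (0 : ℝ) < a / 2 ^ m := by positivity
    have hm : (0 : ℝ) < 1 / 2 ^ m := by positivity
    have e : ∀ i : ℕ, (1 : ℝ) / 2 ^ (m + i) = 1 / 2 ^ m / 2 ^ i := fun i => by rw [pow_add, div_div]
    exact ⟨⟨1 / 2 ^ m, hm, Q _, isLatticePolygon_dyadicBox m ha _ (hQ _ hw).1, φQ _, xQ _, hφQ _,
        rfl, funext fun i => congrArg _ (e i)⟩,
      ⟨1 / 2 ^ m, hm, Q' _, isLatticePolygon_dyadicBox m ha _ (hQ' _ hw).1, φQ' _, xQ' _, hφQ' _,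
        hflip _ hw (φQ _) (xQ _) (φQ' _) (xQ' _) (hφQ _) (hφQ' _),
        funext fun i => congrArg _ (e i)⟩⟩
  -- box limits (S5a), `g' = 1 - g`
  have H5 : ∀ w : ℝ, 0 < w →
      Tendsto (fun n => bondDomainCrossingProb (Q w) (1 / 2 ^ (κ (σ n)))) atTop (𝓝 (g w)) ∧
      Tendsto (fun n => bondDomainCrossingProb (Q' w) (1 / 2 ^ (κ (σ n)))) atTop (𝓝 (1 - g w)) := by
    intro w hw
    obtain ⟨h1, h2⟩ := hlim w hw
    have e : g' w = 1 - g w := by have := hsum w hw; linarith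
    exact ⟨h1, e ▸ h2⟩
  -- continuity of the modulus of `Q w` in `w`
  have H7 : ∀ w₀ : ℝ, 0 < w₀ → ∀ ε : ℝ, 0 < ε → ∃ ρ : ℝ, 0 < ρ ∧ ∀ w : ℝ, 0 < w →
      |w - w₀| < ρ → |crossRatio (xQ w) - crossRatio (xQ w₀)| < ε := by
    intro w₀ hw₀ ε hε
    obtain ⟨ρ, hρ, H⟩ := hmod w₀ hw₀ ε hε
    exact ⟨ρ, hρ, fun w hw hd => H w hw hd (φQ w) (xQ w) (φQ w₀) (xQ w₀) (hφQ w) (hφQ w₀)⟩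
  -- every modulus is attained
  have H8 : ∀ t ∈ Set.Ioo (0 : ℝ) 1, ∃ w : ℝ, 0 < w ∧ crossRatio (xQ w) = t := by
    intro t ht
    obtain ⟨w, hw, H⟩ := hsurj t ht
    exact ⟨w, hw, H (φQ w) (xQ w) (hφQ w)⟩
  -- the abstract cluster law
  obtain ⟨f, hfc, hfs, hlaw⟩ := stub_clusterLawOfComparison_abstract L (fun w => crossRatio (xQ w))
    g (fun w i => bondDomainCrossingProb (Q w) (1 / 2 ^ i))
    (fun w i => bondDomainCrossingProb (Q' w) (1 / 2 ^ i)) (fun n => κ (σ n))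
    H1 H2 H3 H4 H5 hgc H7 H8 hk
  refine ⟨σ, hσ, f, hfc, hfs, ?_, fun h hh P hP ψ y hψ j => ?_⟩
  · -- `f (η_{R₀}) = p` by uniqueness of limits
    have h1 := hlaw (crossRatio x₀) _ ⟨h₀, hh₀, R₀, hR₀, φ₀, x₀, hφ₀, rfl, rfl⟩ 0
      (fun i => bondDomainCrossingProb R₀ (h₀ / 2 ^ i)) fun i => by rw [zero_add]
    exact tendsto_nhds_unique h1 (hp.comp hσ.tendsto_atTop)
  · -- the shifted ladders `h 2^j / 2^(j + i) = h / 2^i`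
    exact hlaw (crossRatio y) _ ⟨h, hh, P, hP, ψ, y, hψ, rfl, rfl⟩ j
      (fun i => bondDomainCrossingProb P (h * 2 ^ j / 2 ^ i)) fun i =>
      congrArg _ (mul_pow_div_pow_add h j i)

end Summit.CriticalPhenomena.CardyFormulaZ2.Cruxes.DyadicLatticeBetaLaw.Stubs

end
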